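import Summits.NavierStokesRegularity.FluidComputer.GateBudgetFirstPin
import HarnessLib

/-!
# What no tuning can beat, part 51: THE LADDER'S BASE, MEMBER-WISE — `√(d² + ã²)` moves by at
# most the dose `∫ρ⁻²c` under a capped trigger, so a lattice dud carries `√(d² + ã²) ≤ ψ₁(k) +
# 245/K⁸` into its second pulse and `≤ ψ₁(k) + δ_k + 1.2·10⁻⁶ ≤ 0.0402` out of it: after two
# pulses `≥ 99.8 %` of the energy is in the carrier (part 49: `99.2 %`, part 46: `98.3 %`)

Cell `pub-fluidc`, blueprint seat bp1 (gen 34, second item, FILE 2 of 2); same namespace and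
conventions as parts 1–50 (`GateBudget*.lean`); imports part 50 (`GateBudgetFirstPin`:
`knob_member_first_state`, `window_gap`, `first_psi_uniform`) and through it part 49
(`knob_dud_second_pin_sharp`: the master tuple with its sharp second pin `δ_k =
kπ/((1.3939)²K¹⁰ - 1) + 1/K¹⁹` and ladder step), part 40 (the pattern of `cold_output_frozen`),
part 37 (`refire_window_facts`), part 1 (energy identity, `c_nonneg`, `traj_abs_le_one`,
`out_energy`) and the Literature toolkit `Thm53.antitoneOn_sub_of_deriv_le`. Headline amplifier
`M = K¹⁰`, `K ≥ 16`, `ε² ≤ 1/(6K²⁰)`, window `200ε/K²⁰ ≤ ρ² ≤ 2ε/K¹⁰`; modes `0 = a` carrier,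
`1 = b` clock, `2 = c` trigger, `3 = d` transfer, `4 = ã` output of `rotorCircuit K K¹⁰ ε ρ`
from (5.6); `t₋ = √(2 - 24 log K/K¹⁰)`, `t₊ = √(2 + 2/K¹⁰) + 242/K⁹`; `ψ₁ = ψ₁(k) = kπ/(0.49K¹⁰ -
1) + 2/K¹⁰` (part 50). HONEST FRAMING (verbatim): low prior, high value-of-information
experiment on Tao's machine paradigm; NOT a claim that NS blows up. Nothing is proved about
the Navier–Stokes equations.

THE POINT (SPEC-INPUT-bp1 §AU successor (20′a), FILE 2: the DOSE and the BASE RUNG).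
* §150 `cold_sqrt_frozen` / `knob_sqrt_frozen`: for ANY couplings (`σ, R ≥ 0`), `T ≥ 0` and
  `c ≤ c₁` on `[T, T']`: `√(d(t)² + ã(t)²) ≤ √(d(T)² + ã(T)²) + Rc₁(t - T)` — the square root
  of part 40's pair law `|Δ(d² + ã²)| ≤ Rc₁(t - T)`: `∂ₜ√(d² + ã² + η²) = Rcad/√(…) ≤ Rc₁` for
  every `η > 0` (`|a| ≤ 1`, `|d| ≤ √(d² + ã² + η²)`). At the level of `√(d² + ã²)` a cold window
  costs its DOSE `≤ 3/K⁹`, not `√dose ≈ 7·10⁻⁶`: this is input (β) of part 49's READING.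
* §151 `knob_member_first_sqrt`: for a lattice member and ANY times `t₊ ≤ tz ≤ t₊ + 1.4242`,
  `tz ≤ r₁ ≤ tz + 3/2` with `c ≤ ρ²/K⁹` on `[tz, r₁]`: `√(d² + ã²) ≤ ψ₁ + 245/K⁸` at `tz` AND at
  `r₁` — part 50's exit pair `|d(T)| + ã(T) ≤ ψ₁ + 244/K⁸` at the dousing time `T ∈ (t₋, t₊]`,
  §150 across part 38's cold window `[T, T + 2.8282] ∋ tz` (part 50's `window_gap`), and §150
  again across `[tz, r₁]`. Stated for ANY such `tz, r₁`, so that it applies to part 49's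
  master tuple and to every later rung's.
* §152 `knob_dud_ladder_base`: on part 49's master tuple `(T, tz, r₁, T₂)` (its timing, second
  clock, residue, cold window and sharp pin re-exported): `√(d² + ã²)(tz), √(d² + ã²)(r₁) ≤ ψ₁ +
  245/K⁸`; by part 49's ladder step `√(d² + ã²)(T₂) ≤ ψ₁ + δ_k + 245/K⁸ + 11/10⁷`; uniformly
  (`ψ₁ ≤ 0.03206`, `δ_k ≤ 0.0081`) `√(d² + ã²)(T₂) ≤ 0.0402`, so `d(T₂)² + ã(T₂)² ≤ 1/600` (part
  49: `3/400`; part 46: `1/60`) and the carrier `a(T₂)² ≥ 599/600 - 10⁻⁵` (energy identity).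

READING (the ladder, re-posed by SPEC §AU). Member-wise, after two pulses `√(d² + ã²) ≤ ψ₁(k)
+ δ_k + 1.2·10⁻⁶ ≈ 8.0k/K¹⁰ + 1.2·10⁻⁶`: `0.040` at the bottom of the window and `1.2·10⁻⁶`
at its top, where the additive `11/10⁷` is part 49's ROUNDING of part 14's drift `968/K⁸` and
is now the per-pulse floor. With part 47's re-arming threshold `√(d² + ã²) < 0.129` the ladder
from here has `≳ (0.129 - 0.0402)/(0.0081 + 1.2·10⁻⁶ + 3/K⁹) ≈ 11` more rungs at the bottom
and `≈ 10⁵` (floor-limited) at the top; inputs still open: (γ) parts 39/45/47's window and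
re-ignition laws free of the horizon caps, and the drift re-typed as `O(K⁻⁸)` (SPEC (20′b)).
HONEST LIMITS. (i) Upper side only; (ii) first ring `0.7ε` (part 50 (ii)); (iii) lattice
members only, `M = K¹⁰`, `K ≥ 16`, `200ε/K²⁰ ≤ ρ² ≤ 2ε/K¹⁰`, `ε² ≤ 1/(6K²⁰)`; (iv) two pulses,
no induction yet; (v) nothing about Navier–Stokes.
[cite: Tao2016AveragedNS, §5.5 Theorem 5.3, (5.5), (5.6), (b-eq), (c-eq), (dora), (tcable),
(energy-con)]
-/

noncomputable section

namespace Summit.NavierStokesRegularity.FluidComputer.GateBudget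

open Real Set Filter Topology
open Literature.Analysis.FluidPDE.Tao2016AveragedNS
open Literature.Analysis.FluidPDE.Tao2016AveragedNS.Thm53 (antitoneOn_sub_of_deriv_le)

variable {K ε σ μ R ρ : ℝ} {X : ℝ → Fin 5 → ℝ} {C : ℝ → ℝ}

/-! ## §150 The output AMPLITUDE under a capped trigger moves by at most the dose -/

/-- **THE OUTPUT AMPLITUDE IS FROZEN UNDER A CAPPED TRIGGER.** Any couplings with `σ, R ≥ 0`,
the trajectory from (5.6), `T ≥ 0` and the trigger capped on `[T, T']` (`c ≤ c₁` there): for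
every `t ∈ [T, T']`, `√(d(t)² + ã(t)²) ≤ √(d(T)² + ã(T)²) + Rc₁(t - T)` — the square root of
part 40's §120: `∂ₜ√(d² + ã² + η²) = Rcad/√(d² + ã² + η²) ≤ Rc₁` (`0 ≤ c ≤ c₁` after `0`,
`|a| ≤ 1` (energy-con), `|d| ≤ √(d² + ã² + η²)`), for every `η > 0`. This is the DOSE bound of
the pulse ladder at the level of `√(d² + ã²)` (part 40's pair-level `c₁(t - T)/ρ²` would cost
`√dose` per window). [cite: Tao2016AveragedNS, §5.5 (5.5), (dora), (energy-con)] -/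
theorem cold_sqrt_frozen (hX : ∀ t, HasDerivAt X (fiveGateCircuit ε σ μ R K (X t)) t)
    (h0 : X 0 = delayInit) (hσ : 0 ≤ σ) (hR : 0 ≤ R) {T T' c₁ : ℝ} (hT : 0 ≤ T)
    (hc : ∀ r ∈ Icc T T', X r 2 ≤ c₁) {t : ℝ} (ht : t ∈ Icc T T') :
    √(X t 3 ^ 2 + X t 4 ^ 2) ≤ √(X T 3 ^ 2 + X T 4 ^ 2) + R * c₁ * (t - T) := by
  refine le_of_forall_pos_le_add fun η hη => ?_
  have hpos : ∀ r, 0 < X r 3 ^ 2 + X r 4 ^ 2 + η ^ 2 := fun r => by positivity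
  -- the regularised amplitude `√(d² + ã² + η²)` and its derivative
  have hfd : ∀ r, HasDerivAt (fun s => √(X s 3 ^ 2 + X s 4 ^ 2 + η ^ 2))
      (2 * R * X r 2 * X r 0 * X r 3 / (2 * √(X r 3 ^ 2 + X r 4 ^ 2 + η ^ 2))) r :=
    fun r => ((out_energy (hX r)).add_const (η ^ 2)).sqrt (hpos r).ne'
  have hmono := antitoneOn_sub_of_deriv_le
    (f := fun s => √(X s 3 ^ 2 + X s 4 ^ 2 + η ^ 2))
    (f' := fun r => 2 * R * X r 2 * X r 0 * X r 3 / (2 * √(X r 3 ^ 2 + X r 4 ^ 2 + η ^ 2)))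
    (φ := fun _ => R * c₁ * 1) (Φ := fun r => R * c₁ * (r - T)) (convex_Icc T T')
    (fun r _ => hfd r) (fun r _ => ((hasDerivAt_id' r).sub_const T).const_mul (R * c₁))
    (fun r hr => by
      show 2 * R * X r 2 * X r 0 * X r 3 / (2 * √(X r 3 ^ 2 + X r 4 ^ 2 + η ^ 2)) ≤ R * c₁ * 1
      have hc0 : 0 ≤ X r 2 := c_nonneg hX h0 hσ (hT.trans hr.1)
      have hc1 : X r 2 ≤ c₁ := hc r hr
      have ha : |X r 0| ≤ 1 := traj_abs_le_one hX h0 r 0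
      have hF : 0 < √(X r 3 ^ 2 + X r 4 ^ 2 + η ^ 2) := Real.sqrt_pos.2 (hpos r)
      have hdF : |X r 3| ≤ √(X r 3 ^ 2 + X r 4 ^ 2 + η ^ 2) := by
        rw [← Real.sqrt_sq_eq_abs]
        exact Real.sqrt_le_sqrt (by nlinarith [sq_nonneg (X r 4), sq_nonneg η])
      have had : X r 0 * X r 3 ≤ √(X r 3 ^ 2 + X r 4 ^ 2 + η ^ 2) := by
        have h1 : X r 0 * X r 3 ≤ |X r 0| * |X r 3| := by
          rw [← abs_mul]; exact le_abs_self _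
        nlinarith [h1, ha, abs_nonneg (X r 0), abs_nonneg (X r 3), hdF]
      have h3 : X r 2 * (X r 0 * X r 3) ≤ X r 2 * √(X r 3 ^ 2 + X r 4 ^ 2 + η ^ 2) :=
        mul_le_mul_of_nonneg_left had hc0
      have h4 : X r 2 * √(X r 3 ^ 2 + X r 4 ^ 2 + η ^ 2)
          ≤ c₁ * √(X r 3 ^ 2 + X r 4 ^ 2 + η ^ 2) := mul_le_mul_of_nonneg_right hc1 hF.le
      rw [div_le_iff₀ (by positivity)]
      nlinarith [h3, h4, hR])
  have h := hmono (left_mem_Icc.2 (ht.1.trans ht.2)) ht ht.1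
  dsimp only at h
  have hPT : 0 ≤ X T 3 ^ 2 + X T 4 ^ 2 := by positivity
  have hsT : 0 ≤ √(X T 3 ^ 2 + X T 4 ^ 2) := Real.sqrt_nonneg _
  have hηT : √(X T 3 ^ 2 + X T 4 ^ 2 + η ^ 2) ≤ √(X T 3 ^ 2 + X T 4 ^ 2) + η :=
    (Real.sqrt_le_left (by positivity)).2 (by nlinarith [Real.sq_sqrt hPT, hsT, hη.le])
  have hηt : √(X t 3 ^ 2 + X t 4 ^ 2) ≤ √(X t 3 ^ 2 + X t 4 ^ 2 + η ^ 2) :=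
    Real.sqrt_le_sqrt (by nlinarith [sq_nonneg η])
  have e1 : R * c₁ * (T - T) = 0 := by ring
  linarith [h, hηT, hηt, e1]

/-- **THE OUTPUT AMPLITUDE OF A KNOB CIRCUIT UNDER A CAPPED TRIGGER.** Any `rotorCircuit K M ε
ρ` (`ρ > 0`), the trajectory from (5.6), `T ≥ 0`, `c ≤ c₁` on `[T, T + H]`: `√(d(t)² + ã(t)²) ≤
√(d(T)² + ã(T)²) + (c₁/ρ²)(t - T)` there — §150 at `σ = ρ²e^{-M}`, `R = ρ⁻²`.
[cite: Tao2016AveragedNS, §5.5 (5.5), (dora), (energy-con)] -/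
theorem knob_sqrt_frozen {M : ℝ}
    (hX : ∀ t, HasDerivAt X (RotorKnob.rotorCircuit K M ε ρ (X t)) t)
    (h0 : X 0 = delayInit) (hρ : 0 < ρ) {T H c₁ : ℝ} (hT : 0 ≤ T)
    (hc : ∀ r ∈ Icc T (T + H), X r 2 ≤ c₁) :
    ∀ t ∈ Icc T (T + H),
      √(X t 3 ^ 2 + X t 4 ^ 2) ≤ √(X T 3 ^ 2 + X T 4 ^ 2) + c₁ / ρ ^ 2 * (t - T) := by
  have hXf := hX
  rw [RotorKnob.rotorCircuit_eq_fiveGate] at hXf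
  intro t ht
  have h := cold_sqrt_frozen hXf h0 (by positivity) (by positivity) hT hc ht
  rw [show c₁ / ρ ^ 2 * (t - T) = (ρ ^ 2)⁻¹ * c₁ * (t - T) by rw [div_eq_mul_inv]; ring]
  exact h

/-! ## §151 The amplitude of a lattice member until it re-arms -/

/-- **THE AMPLITUDE OF A LATTICE MEMBER UNTIL IT RE-ARMS.** `K ≥ 16`, `0 < ε`, `ε² ≤ 1/(6K²⁰)`,
an exact trajectory of `rotorCircuit K K¹⁰ ε ρ` from (5.6) with `200ε/K²⁰ ≤ ρ² ≤ 2ε/K¹⁰` ON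
THE LATTICE `ε = kK¹⁰ρ²`, and ANY two times with `t₊ ≤ tz ≤ t₊ + 1.4242`, `tz ≤ r₁ ≤ tz + 3/2`
and `c ≤ ρ²/K⁹` on `[tz, r₁]`: `√(d(tz)² + ã(tz)²) ≤ ψ₁ + 245/K⁸`, `√(d(r₁)² + ã(r₁)²) ≤ ψ₁ +
245/K⁸`, `ψ₁ ≤ 0.03206` — part 50's exit pair at its dousing time `T ∈ (t₋, t₊]` (`√(d² + ã²)
≤ |d| + ã ≤ ψ₁ + 244/K⁸`), §150 across part 38's cold window `[T, T + 2.8282] ∋ tz` (part 50's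
`t₊ ≤ t₋ + 10⁻³`), and §150 across `[tz, r₁]`; total dose `≤ 4.4/K⁹ ≤ 0.3/K⁸`.
[cite: Tao2016AveragedNS, §5.5 Theorem 5.3, (5.5), (5.6), (b-eq), (c-eq), (dora), (energy-con)] -/
theorem knob_member_first_sqrt
    (hX : ∀ t, HasDerivAt X (RotorKnob.rotorCircuit K (K ^ 10) ε ρ (X t)) t)
    (h0 : X 0 = delayInit) (hC : ∀ t, HasDerivAt C (X t 2) t) (hK : 16 ≤ K) (hε : 0 < ε)
    (hεK : ε ^ 2 ≤ 1 / (6 * K ^ 20)) (hρ : 0 < ρ) (hlo : 200 * ε / K ^ 20 ≤ ρ ^ 2)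
    (hhi : K ^ 10 * ρ ^ 2 ≤ 2 * ε) (k : ℕ) (hk : ε = k * K ^ 10 * ρ ^ 2) {tz r₁ : ℝ}
    (hz1 : √(2 + 2 / K ^ 10) + 242 / K ^ 9 ≤ tz)
    (hz2 : tz ≤ √(2 + 2 / K ^ 10) + 242 / K ^ 9 + 14242 / 10000) (hzr : tz ≤ r₁)
    (hrz : r₁ ≤ tz + 3 / 2) (hcap : ∀ r ∈ Icc tz r₁, X r 2 ≤ ρ ^ 2 / K ^ 9) :
    √(X tz 3 ^ 2 + X tz 4 ^ 2) ≤ k * π / (49 / 100 * K ^ 10 - 1) + 2 / K ^ 10 + 245 / K ^ 8 ∧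
      √(X r₁ 3 ^ 2 + X r₁ 4 ^ 2) ≤ k * π / (49 / 100 * K ^ 10 - 1) + 2 / K ^ 10 + 245 / K ^ 8 ∧
      k * π / (49 / 100 * K ^ 10 - 1) + 2 / K ^ 10 ≤ 3206 / 100000 := by
  have hK0 : 0 < K := by linarith
  have hK9 : 0 < K ^ 9 := by positivity
  obtain ⟨s₀, T, -, -, hs1, -, hsT, -, hlow, hTt, -, -, -, hcold, he0, -, -, -, hsum, hψu⟩ :=
    knob_member_first_state hX h0 hC hK hε hεK hρ hlo hhi k hk
  have hT0 : 0 ≤ T := by linarith only [hs1, hsT]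
  have hgap := window_gap hK
  -- `tz` lies in the first cold window `[T, T + 2.8282]`
  have htz : tz ∈ Icc T (T + 28282 / 10000) :=
    ⟨hTt.trans hz1, by linarith only [hz2, hgap, hlow, hsT]⟩
  have htz0 : 0 ≤ tz := hT0.trans htz.1
  -- `√(d² + ã²)(T) ≤ |d(T)| + ã(T)`
  have hsqT : √(X T 3 ^ 2 + X T 4 ^ 2) ≤ |X T 3| + X T 4 := by
    refine (Real.sqrt_le_left (add_nonneg (abs_nonneg _) he0)).2 ?_
    have hsq : |X T 3| ^ 2 = X T 3 ^ 2 := sq_abs _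
    nlinarith only [hsq, mul_nonneg (abs_nonneg (X T 3)) he0]
  have hγ : ρ ^ 2 / K ^ 9 / ρ ^ 2 = 1 / K ^ 9 := by
    field_simp
  -- §150 across the cold window, then across `[tz, r₁]`
  have h1 := knob_sqrt_frozen hX h0 hρ hT0 (H := 28282 / 10000) (c₁ := ρ ^ 2 / K ^ 9)
    (fun r hr => (hcold r hr).le) tz htz
  have hr₁ : r₁ ∈ Icc tz (tz + (r₁ - tz)) := ⟨hzr, by linarith only⟩
  have h2 := knob_sqrt_frozen hX h0 hρ htz0 (H := r₁ - tz) (c₁ := ρ ^ 2 / K ^ 9)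
    (fun r hr => hcap r ⟨hr.1, by linarith only [hr.2]⟩) r₁ hr₁
  rw [hγ] at h1 h2
  have hd1 : 1 / K ^ 9 * (tz - T) ≤ 1 / K ^ 9 * (28282 / 10000) :=
    mul_le_mul_of_nonneg_left (by linarith only [htz.2]) (one_div_pos.2 hK9).le
  have hd2 : 1 / K ^ 9 * (r₁ - tz) ≤ 1 / K ^ 9 * (3 / 2) :=
    mul_le_mul_of_nonneg_left (by linarith only [hrz]) (one_div_pos.2 hK9).le
  have hsmall : (1 : ℝ) / K ^ 9 * (28282 / 10000) + 1 / K ^ 9 * (3 / 2) ≤ 1 / K ^ 8 := by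
    rw [show (1 : ℝ) / K ^ 9 = 1 / K * (1 / K ^ 8) by field_simp]
    have h16 : (1 : ℝ) / K ≤ 1 / 16 := one_div_le_one_div_of_le (by norm_num) hK
    have h80 : (0 : ℝ) < 1 / K ^ 8 := by positivity
    nlinarith only [h16, h80]
  refine ⟨?_, ?_, hψu⟩
  · linarith only [h1, hsqT, hsum, hd1, hd2, hsmall, show (0 : ℝ) ≤ 1 / K ^ 9 * (3 / 2) by
      positivity, show (245 : ℝ) / K ^ 8 = 244 / K ^ 8 + 1 / K ^ 8 by ring]
  · linarith only [h1, h2, hsqT, hsum, hd1, hd2, hsmall,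
      show (245 : ℝ) / K ^ 8 = 244 / K ^ 8 + 1 / K ^ 8 by ring]

/-! ## §152 The ladder's base: a lattice dud after two pulses, member-wise -/

/-- **THE LADDER'S BASE, MEMBER-WISE.** `K ≥ 16`, `0 < ε`, `ε² ≤ 1/(6K²⁰)`, an exact trajectory
of `rotorCircuit K K¹⁰ ε ρ` from (5.6) with `200ε/K²⁰ ≤ ρ² ≤ 2ε/K¹⁰` ON THE LATTICE `ε =
kK¹⁰ρ²`, `C` any primitive of the trigger: on part 49's master tuple `(T, tz, r₁, T₂)` — of
which this re-exports the timing `t₋ ≤ T ≤ t₊`, `T + 1.414213 ≤ tz ≤ T + 1.4242`, `T + 2.8282 <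
r₁ < T + 2.8542`, `r₁ < T₂ ≤ r₁ + 242/K⁹`, the second doused state `-1.4401ε ≤ b(T₂) ≤
-1.3939ε`, `c(T₂) ≤ 2ρ²/K¹⁰`, its cold window `c < ρ²/K⁹` on `[T₂, T₂ + 2.7878]`, the index
window `1 ≤ k ≤ K¹⁰/200`, the sharp pin `|(C(T₂) - C(r₁))/ρ² - kπ| ≤ δ_k ≤ 0.0081` and the
ladder step (the remaining conclusions of §145 are recovered by applying §151 to §145's own
tuple, as here) — NEW: `√(d² + ã²) ≤ ψ₁ + 245/K⁸` at `tz` and at `r₁` (§151); `√(d² + ã²)(T₂) ≤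
ψ₁ + δ_k + 245/K⁸ + 11/10⁷ ≤ 0.0402`; `d(T₂)² + ã(T₂)² ≤ 1/600`; `a(T₂)² ≥ 599/600 - 10⁻⁵`.
[cite: Tao2016AveragedNS, §5.5 Theorem 5.3, (5.5), (5.6), (b-eq), (c-eq), (dora), (tcable),
(energy-con)] -/
theorem knob_dud_ladder_base
    (hX : ∀ t, HasDerivAt X (RotorKnob.rotorCircuit K (K ^ 10) ε ρ (X t)) t)
    (h0 : X 0 = delayInit) (hC : ∀ t, HasDerivAt C (X t 2) t) (hK : 16 ≤ K) (hε : 0 < ε)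
    (hεK : ε ^ 2 ≤ 1 / (6 * K ^ 20)) (hρ : 0 < ρ) (hlo : 200 * ε / K ^ 20 ≤ ρ ^ 2)
    (hhi : K ^ 10 * ρ ^ 2 ≤ 2 * ε) (k : ℕ) (hk : ε = k * K ^ 10 * ρ ^ 2) :
    ∃ T tz r₁ T₂ : ℝ, √(2 - 24 * Real.log K / K ^ 10) ≤ T ∧
      T ≤ √(2 + 2 / K ^ 10) + 242 / K ^ 9 ∧ T + 1414213 / 1000000 ≤ tz ∧
      tz ≤ T + 14242 / 10000 ∧ T + 28282 / 10000 < r₁ ∧ r₁ < T + 28542 / 10000 ∧ r₁ < T₂ ∧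
      T₂ - r₁ ≤ 242 / K ^ 9 ∧ -(14401 / 10000 * ε) ≤ X T₂ 1 ∧ X T₂ 1 ≤ -(13939 / 10000 * ε) ∧
      X T₂ 2 ≤ 2 * ρ ^ 2 / K ^ 10 ∧ (∀ t ∈ Icc T₂ (T₂ + 27878 / 10000), X t 2 < ρ ^ 2 / K ^ 9) ∧
      (1 : ℝ) ≤ k ∧ 200 * (k : ℝ) ≤ K ^ 10 ∧
      |(C T₂ - C r₁) / ρ ^ 2 - k * π|
        ≤ k * π / ((13939 / 10000) ^ 2 * K ^ 10 - 1) + 1 / K ^ 19 ∧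
      k * π / ((13939 / 10000) ^ 2 * K ^ 10 - 1) + 1 / K ^ 19 ≤ 81 / 10000 ∧
      √(X T₂ 3 ^ 2 + X T₂ 4 ^ 2) ≤ √(X r₁ 3 ^ 2 + X r₁ 4 ^ 2)
        + (k * π / ((13939 / 10000) ^ 2 * K ^ 10 - 1) + 1 / K ^ 19) + 11 / 10 ^ 7 ∧
      √(X tz 3 ^ 2 + X tz 4 ^ 2) ≤ k * π / (49 / 100 * K ^ 10 - 1) + 2 / K ^ 10 + 245 / K ^ 8 ∧
      √(X r₁ 3 ^ 2 + X r₁ 4 ^ 2) ≤ k * π / (49 / 100 * K ^ 10 - 1) + 2 / K ^ 10 + 245 / K ^ 8 ∧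
      k * π / (49 / 100 * K ^ 10 - 1) + 2 / K ^ 10 ≤ 3206 / 100000 ∧
      √(X T₂ 3 ^ 2 + X T₂ 4 ^ 2) ≤ k * π / (49 / 100 * K ^ 10 - 1) + 2 / K ^ 10
        + (k * π / ((13939 / 10000) ^ 2 * K ^ 10 - 1) + 1 / K ^ 19) + 245 / K ^ 8
        + 11 / 10 ^ 7 ∧
      √(X T₂ 3 ^ 2 + X T₂ 4 ^ 2) ≤ 402 / 10000 ∧ X T₂ 3 ^ 2 + X T₂ 4 ^ 2 ≤ 1 / 600 ∧
      599 / 600 - 1 / 10 ^ 5 ≤ X T₂ 0 ^ 2 := by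
  have hK0 : 0 < K := by linarith
  have h8 : (4294967296 : ℝ) ≤ K ^ 8 := by
    have := headline_pow_floor hK 8; norm_num at this; exact this
  have h10 : (1099511627776 : ℝ) ≤ K ^ 10 := by
    have := headline_pow_floor hK 10; norm_num at this; exact this
  obtain ⟨hq1, -, -, -, -, -, hρε, -, -, -, -, hεq, -⟩ := refire_window_facts hK hε hεK hhi
  have hXf := hX
  rw [RotorKnob.rotorCircuit_eq_fiveGate] at hXf
  -- part 49's master tuple: (a) part 41, (b) part 43, (c) part 45, (d) part 46, (e) part 49
  obtain ⟨T, tz, r₁, T₂, ⟨-, -, hsT, hτ, hc, -, -, -, -, -, -, -⟩,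
      ⟨hT1, hT2, -, -, htz1, htz2, -, hpost, hTr1, hTr2, -⟩, ⟨-, -, -, hbT₂l, hbT₂u, hcold⟩,
      ⟨hcT2, -, -, -, -, -⟩, hk1, hk200, hpinS, -, -, -, -, hstep⟩ :=
    knob_dud_second_pin_sharp hX h0 hC hK hε hεK hρ hlo hhi k hk
  have hgap := window_gap hK
  -- §151 on the tuple's `tz ≤ r₁`
  obtain ⟨hz, hr, hψu⟩ := knob_member_first_sqrt hX h0 hC hK hε hεK hρ hlo hhi k hk
    (tz := tz) (r₁ := r₁) (by linarith only [htz1, hT1, hgap]) (by linarith only [htz2, hT2])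
    (by linarith only [htz2, hTr1]) (by linarith only [htz1, hTr2])
    (fun r hr => (hpost r hr).1)
  -- the sharp pin, uniformly (as in part 49): `k ≤ K¹⁰/200`, `π < 3.1416`, `K¹⁰ ≥ 2⁴⁰`
  have hk0 : (0 : ℝ) ≤ k := by linarith only [hk1]
  have hden : 0 < (13939 / 10000 : ℝ) ^ 2 * K ^ 10 - 1 := by nlinarith only [h10]
  have hA : k * π / ((13939 / 10000 : ℝ) ^ 2 * K ^ 10 - 1) ≤ 80849 / 10000000 := by
    rw [div_le_iff₀ hden]
    have hkπ : (k : ℝ) * π ≤ k * 3.1416 := mul_le_mul_of_nonneg_left Real.pi_lt_d4.le hk0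
    nlinarith only [hkπ, hk200, h10, hk0]
  have h19 : (1 : ℝ) / K ^ 19 ≤ 1 / 10000000 := by
    have : (16 : ℝ) ^ 19 ≤ K ^ 19 := headline_pow_floor hK 19
    exact one_div_le_one_div_of_le (by norm_num) (by linarith only [this])
  have hδ81 : k * π / ((13939 / 10000 : ℝ) ^ 2 * K ^ 10 - 1) + 1 / K ^ 19 ≤ 81 / 10000 := by
    linarith only [hA, h19]
  -- the amplitude after the second pulse
  have h245 : (245 : ℝ) / K ^ 8 ≤ 245 / 4294967296 :=
    div_le_div_of_nonneg_left (by norm_num) (by norm_num) h8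
  have hT₂ : √(X T₂ 3 ^ 2 + X T₂ 4 ^ 2) ≤ k * π / (49 / 100 * K ^ 10 - 1) + 2 / K ^ 10
      + (k * π / ((13939 / 10000) ^ 2 * K ^ 10 - 1) + 1 / K ^ 19) + 245 / K ^ 8
      + 11 / 10 ^ 7 := by linarith only [hstep, hr]
  have h402 : √(X T₂ 3 ^ 2 + X T₂ 4 ^ 2) ≤ 402 / 10000 := by
    linarith only [hT₂, hψu, hδ81, h245]
  have hP0 : 0 ≤ X T₂ 3 ^ 2 + X T₂ 4 ^ 2 := by positivity
  have hpair : X T₂ 3 ^ 2 + X T₂ 4 ^ 2 ≤ 1 / 600 := by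
    have h := pow_le_pow_left₀ (Real.sqrt_nonneg _) h402 2
    rw [Real.sq_sqrt hP0] at h
    norm_num at h ⊢; linarith only [h]
  -- the carrier, by (energy-con): `b(T₂)² + c(T₂)² ≤ 10⁻⁵`
  have hcT0 : 0 < X T₂ 2 := hc T₂ ⟨hsT.le, le_rfl⟩
  have hρ2 : 0 < ρ ^ 2 := by positivity
  have hε2 : 0 < ε ^ 2 := by positivity
  have hE2 : X T₂ 0 ^ 2 + X T₂ 1 ^ 2 + X T₂ 2 ^ 2 + X T₂ 3 ^ 2 + X T₂ 4 ^ 2 = 1 := by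
    simpa [energy, Fin.sum_univ_five] using energy_init hXf h0 T₂
  have hbc : X T₂ 1 ^ 2 + X T₂ 2 ^ 2 ≤ 1 / 10 ^ 5 := by
    have hb2 : X T₂ 1 ^ 2 ≤ (14401 / 10000 * ε) ^ 2 := by
      rw [← sq_abs]
      exact pow_le_pow_left₀ (abs_nonneg _) (abs_le.2 ⟨hbT₂l, by linarith only [hbT₂u, hε]⟩) 2
    have hc1 : X T₂ 2 ≤ ε := by
      have : 2 * ρ ^ 2 / K ^ 10 = 2 * (1 / K ^ 10) * ρ ^ 2 := by ring
      have h1 : 2 * (1 / K ^ 10) * ρ ^ 2 ≤ 2 * (1 / 1099511627776) * ε :=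
        mul_le_mul (mul_le_mul_of_nonneg_left hq1 (by norm_num)) hρε hρ2.le (by norm_num)
      linarith only [hcT2, this, h1, hε]
    have hc2 : X T₂ 2 ^ 2 ≤ ε ^ 2 := pow_le_pow_left₀ hcT0.le hc1 2
    have hεs : ε ^ 2 ≤ 1 / 6 * (1 / 1099511627776) ^ 2 := by
      have : (1 / K ^ 10) ^ 2 ≤ (1 / 1099511627776 : ℝ) ^ 2 :=
        pow_le_pow_left₀ (by positivity) hq1 2
      linarith only [hεq, this]
    nlinarith only [hb2, hc2, hεs, hε2]
  exact ⟨T, tz, r₁, T₂, hT1, hT2, htz1, htz2, hTr1, hTr2, hsT, hτ, hbT₂l, hbT₂u, hcT2, hcold,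
    hk1, hk200, hpinS, hδ81, hstep, hz, hr, hψu, hT₂, h402, hpair,
    by linarith only [hE2, hpair, hbc]⟩

end Summit.NavierStokesRegularity.FluidComputer.GateBudget
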